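import Summits.CriticalPhenomena.SAWScalingLimit.Theorems.SAWDefectDecoherenceSectorSlavingDefs
import Summits.CriticalPhenomena.SAWScalingLimit.Theorems.SAWDefectDecoherenceDefectDecoherenceTmStarSums
import Summits.CriticalPhenomena.SAWScalingLimit.Theorems.SAWDevelopingMapInteriorFlatteningLiouvilleTransportA
import Summits.CriticalPhenomena.SAWScalingLimit.Theorems.SAWDevelopingMapObservableToSLETypeLadderCarvedReductionTranslation
import HarnessLib

/-!
# Translation covariance of the arrival characters (crux `SAWDefectDecoherence.DefectDecoherence`,
stmt-CriticalPhenomena-8549; line `sector-slaving`, helper stub H1 `ss_translation_covariance`, lead c4)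

Landing target:
`Summits/CriticalPhenomena/SAWScalingLimit/Theorems/SAWDefectDecoherenceDefectDecoherenceSsTranslationCovariance.lean`
(`--supports stmt-CriticalPhenomena-8549`; registered sub-goal `ss_translation_covariance`).

The three neighbours of a deep vertex of the honeycomb lattice `ℍ` are lattice TRANSLATES of one
another; the line `sector-slaving` re-expresses its two star sources through the response of a clean
twisted arrival sum `A_ξ(z) = arrivalSum Λ a θa ξ z` (`…SectorSlavingDefs.lean`) at ONE point to a
unit translation of the configuration `(Λ, a)`.  This file is the exact, purely combinatorial input
of that step, for graph automorphisms `T : hexGraph ≃g hexGraph` acting on the face centres by a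
translation `c_{T f} = c_f + β`:

* `exists_translation` — two vertices with the same sublattice index (`HexVertex = Site 2 × Fin 2`)
  are exchanged by such a `T` (the lattice translation `w ↦ (x + w.1, w.2)`, `β = triEmbed x`, an
  automorphism by `hexGraph_adj_translate_iff`, acting by `hexCenter_translate`; built as an
  anonymous structure, no definition is introduced);
* `arrivalSum_image`, `viaSum_image` — `A_ξ(T z; T Λ, T a) = A_ξ(z; Λ, a)` and likewise for the full
  via-dart sums: the walks `a → s(s, z)` of `Λ` and the walks `T a → s(T s, T z)` of `T Λ`
  correspond by `γ ↦ T ∘ γ` (`exists_equiv_walks`, from `…Liouville.Transport.exists_walk_map`),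
  with the same length and the same winding (every point of the polyline moves by `z ↦ z + β`,
  `…Liouville.Transport.winding_eq_of_verts_eq` with `α = 1`), and the predicates "last vertex `s`"
  / "`z` not visited" are transported by injectivity (`sum_walks_image`);
* `mass_image`, `rootAngle_map`, `star_image`, `deep_image_iff` (and
  `…Liouville.Transport.hexDomainSimplyConnected_image_iff`) — the star mass (invariance of the
  parafermionic observable, `hexParafermionicObservable_image_mk`), the root direction (differences
  of centres are unchanged), the star (adjacency is preserved), depth (a translation is an isometry
  of the centres) and simple connectivity are transported;
* `ss_translation_covariance` — the registered packaging.

Sources: H. Duminil-Copin, S. Smirnov, Ann. of Math. 175 (2012) 1653–1665 (arXiv:1007.0575), §1–2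
(walks between mid-edges, the winding as total rotation); translation invariance of the honeycomb
lattice (folklore).  The walk bijection is adapted from
`…InteriorFlattening.Liouville.Transport.hexParafermionicObservable_image`.  Deliberately NOT here:
any estimate (the sector-Lipschitz response itself is the business of the line's other stubs).
-/

noncomputable section

open scoped BigOperators ComplexConjugate Classical
open Literature.Probability.LatticeModels Literature.Probability.RandomPlanarGeometry.SAW
open Summit.CriticalPhenomena.SAWScalingLimit.Theorems.DefectDecoherence.TipMartingale

namespace Summit.CriticalPhenomena.SAWScalingLimit.Theorems.DefectDecoherence.SectorSlaving

/-! ### Translations between vertices of the same sublattice -/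

open Summit.CriticalPhenomena.SAWScalingLimit.Theorems.ObservableToSLE.TypeLadder in
/-- **Same-sublattice vertices are translates of each other**: for `t = (p, k)`, `t' = (p', k)` the
lattice translation `w ↦ (p' - p + w.1, w.2)` is a graph automorphism of `ℍ` carrying `t` to `t'`
and acting on the face centres by `z ↦ z + triEmbed (p' - p)`. [folklore] -/
theorem exists_translation : ∀ t t' : HexVertex, t.2 = t'.2 →
    ∃ (T : hexGraph ≃g hexGraph) (β : ℂ), T t = t' ∧
      ∀ f : HexVertex, hexCenter (T f) = hexCenter f + β := by
  intro t t' h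
  obtain ⟨x, hx⟩ : ∃ x : Site 2, x + t.1 = t'.1 := ⟨t'.1 - t.1, sub_add_cancel _ _⟩
  refine ⟨{ toFun := fun w => (x + w.1, w.2)
            invFun := fun w => (-x + w.1, w.2)
            left_inv := fun w => by obtain ⟨c, j⟩ := w; simp
            right_inv := fun w => by obtain ⟨c, j⟩ := w; simp
            map_rel_iff' := fun {u w} => hexGraph_adj_translate_iff x u w },
    triEmbed x, ?_, fun f => ?_⟩
  · show ((x + t.1, t.2) : HexVertex) = t'
    exact Prod.ext hx h
  · show hexCenter ((x + f.1, f.2) : HexVertex) = hexCenter f + triEmbed x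
    exact hexCenter_translate x f

/-! ### Images of stars, masses, root directions, depth -/

/-- **The star is transported**: the star of `T z` in `T Λ` is the image of the star of `z` in `Λ`
(a graph automorphism preserves adjacency). [folklore] -/
theorem star_image (T : hexGraph ≃g hexGraph) (Λ : Finset HexVertex) (z : HexVertex) :
    star (Λ.image T) (T z) = (star Λ z).image T := by
  ext w
  simp only [TipMartingale.star, Finset.mem_filter, Finset.mem_image]
  constructor
  · rintro ⟨⟨v, hv, rfl⟩, hadj⟩
    exact ⟨v, ⟨hv, T.map_rel_iff.1 hadj⟩, rfl⟩
  · rintro ⟨v, ⟨hv, hadj⟩, rfl⟩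
    exact ⟨⟨v, hv, rfl⟩, T.map_rel_iff.2 hadj⟩

open Summit.CriticalPhenomena.SAWScalingLimit.Theorems.InteriorFlattening.Liouville.Transport in
/-- **The star mass is transported**: `M(T Λ, s(T u, T w), T z) = M(Λ, s(u, w), z)` for an
automorphism acting on the centres by a translation — the star of `T z` is the image of the star of
`z` and the parafermionic observable is invariant (`hexParafermionicObservable_image_mk`, `α = 1`).
[folklore] -/
theorem mass_image (T : hexGraph ≃g hexGraph) {β : ℂ}
    (hT : ∀ f : HexVertex, hexCenter (T f) = hexCenter f + β) (Λ : Finset HexVertex)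
    (u w z : HexVertex) : mass (Λ.image T) (T u) (T w) (T z) = mass Λ u w z := by
  have hT1 : ∀ f : HexVertex, hexCenter (T f) = 1 * hexCenter f + β := fun f => by
    rw [one_mul]; exact hT f
  unfold mass
  rw [star_image, Finset.sum_image T.injective.injOn]
  refine Finset.sum_congr rfl fun t _ => ?_
  have h := hexParafermionicObservable_image_mk T one_ne_zero hT1 Λ s(u, w) z t xc 0
  rw [Sym2.map_mk] at h
  rw [h]

/-- **The root direction is transported**: `θ_{T a} = θ_a` (differences of centres are unchanged by
a translation). [folklore] -/
theorem rootAngle_map (T : hexGraph ≃g hexGraph) {β : ℂ}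
    (hT : ∀ f : HexVertex, hexCenter (T f) = hexCenter f + β) (u w : HexVertex) :
    rootAngle (T u) (T w) = rootAngle u w := by
  unfold rootAngle
  rw [hT, hT, add_sub_add_right_eq_sub]

open Summit.CriticalPhenomena.SAWScalingLimit.Theorems.InteriorFlattening.Liouville.Transport in
/-- **Depth is transported**: `z` is `R`-deep in `Λ` iff `T z` is `R`-deep in `T Λ` (a translation of
the centres is an isometry; `ball_subset_image_iff` with `α = 1`). [folklore] -/
theorem deep_image_iff (T : hexGraph ≃g hexGraph) {β : ℂ}
    (hT : ∀ f : HexVertex, hexCenter (T f) = hexCenter f + β) (Λ : Finset HexVertex)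
    (z : HexVertex) (R : ℝ) : Deep Λ z R ↔ Deep (Λ.image T) (T z) R := by
  have hT1 : ∀ f : HexVertex, hexCenter (T f) = 1 * hexCenter f + β := fun f => by
    rw [one_mul]; exact hT f
  unfold Deep
  exact (ball_subset_image_iff T norm_one hT1 Λ z R).symm

/-! ### Transport of the twisted walk sums -/

open Summit.CriticalPhenomena.SAWScalingLimit.Theorems.InteriorFlattening.Liouville.Transport in
/-- **The walk bijection `γ ↦ T ∘ γ`** between the walks of `Λ` from `a` to `z` and the walks of
`T Λ` from `T a` to `T z`, translating vertex lists (the companion walks along `T` and along `T⁻¹`,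
`exists_walk_map`, are mutually inverse; adapted from
`…Liouville.Transport.hexParafermionicObservable_image`). [folklore] -/
theorem exists_equiv_walks (T : hexGraph ≃g hexGraph) (Λ : Finset HexVertex)
    (a z : Sym2 HexVertex) :
    ∃ e : HexMidEdgeSAW Λ a z ≃ HexMidEdgeSAW (Λ.image T) (a.map T) (z.map T),
      ∀ γ, (e γ).verts = γ.verts.map T := by
  choose f hf using fun γ : HexMidEdgeSAW Λ a z =>
    exists_walk_map T (Λ₂ := Λ.image T) (fun v hv => Finset.mem_image_of_mem _ hv) rfl rfl γ
  choose g hg using fun γ' : HexMidEdgeSAW (Λ.image T) (a.map T) (z.map T) =>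
    exists_walk_map T.symm (Λ₂ := Λ) (fun v hv => (mem_image_iff T).1 hv)
      (map_symm_map T a).symm (map_symm_map T z).symm γ'
  have hgf : ∀ γ, g (f γ) = γ := fun γ => HexMidEdgeSAW.ext <| by
    rw [hg, hf, List.map_map]
    conv_rhs => rw [← List.map_id γ.verts]
    exact List.map_congr_left fun v _ => RelIso.symm_apply_apply T v
  have hfg : ∀ γ', f (g γ') = γ' := fun γ' => HexMidEdgeSAW.ext <| by
    rw [hf, hg, List.map_map]
    conv_rhs => rw [← List.map_id γ'.verts]
    exact List.map_congr_left fun v _ => RelIso.apply_symm_apply T v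
  exact ⟨⟨f, g, hgf, hfg⟩, hf⟩

/-- "`T ∘ l` ends at `T s`" iff "`l` ends at `s`" (injectivity of `T`). [folklore] -/
theorem getLast?_map_eq_some_iff (T : hexGraph ≃g hexGraph) (l : List HexVertex) (s : HexVertex) :
    (l.map T).getLast? = some (T s) ↔ l.getLast? = some s := by
  rw [List.getLast?_map]
  exact (Option.map_injective T.injective).eq_iff' rfl

open Summit.CriticalPhenomena.SAWScalingLimit.Theorems.InteriorFlattening.Liouville.Transport in
/-- **Twisted walk sums are transported, dart by dart**: for vertices `s, z` the sum, over the walks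
`T a → s(T s, T z)` of `T Λ` whose vertex list satisfies `Q`, of `x_c^{ℓ+1} e^{-iξ(θ_a + W)}` equals
the same sum over the walks `a → s(s, z)` of `Λ` whose vertex list satisfies `P`, as soon as
`Q (T ∘ l) ↔ P l` — the bijection `γ ↦ T ∘ γ` preserves length and winding. [folklore] -/
theorem sum_walks_image (T : hexGraph ≃g hexGraph) {β : ℂ}
    (hT : ∀ f : HexVertex, hexCenter (T f) = hexCenter f + β) (Λ : Finset HexVertex)
    (a : Sym2 HexVertex) (θa ξ : ℝ) (s z : HexVertex) (P Q : List HexVertex → Prop)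
    [DecidablePred P] [DecidablePred Q] (hPQ : ∀ l : List HexVertex, Q (l.map T) ↔ P l) :
    (∑ γ : HexMidEdgeSAW (Λ.image T) (a.map T) s(T s, T z),
        if Q γ.verts then
          (xc : ℂ) ^ (γ.length + 1) *
            Complex.exp (-Complex.I * (ξ : ℂ) * ((θa + γ.winding : ℝ) : ℂ))
        else 0) =
      ∑ γ : HexMidEdgeSAW Λ a s(s, z),
        if P γ.verts then
          (xc : ℂ) ^ (γ.length + 1) *
            Complex.exp (-Complex.I * (ξ : ℂ) * ((θa + γ.winding : ℝ) : ℂ))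
        else 0 := by
  have hT1 : ∀ f : HexVertex, hexCenter (T f) = 1 * hexCenter f + β := fun f => by
    rw [one_mul]; exact hT f
  obtain ⟨e, he⟩ := exists_equiv_walks T Λ a s(s, z)
  symm
  refine Fintype.sum_equiv e _ _ fun γ => ?_
  refine if_congr ?_ ?_ rfl
  · rw [he, hPQ]
  · -- the summand of the image side is indexed by `s(T s, T z)`, definitionally `(s(s, z)).map T`
    have hl : HexMidEdgeSAW.length (z := s(T s, T z)) (e γ) = γ.length :=
      length_eq_of_verts_eq T γ (e γ) (he γ)
    have hw : HexMidEdgeSAW.winding (z := s(T s, T z)) (e γ) = γ.winding :=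
      winding_eq_of_verts_eq T one_ne_zero hT1 γ (e γ) (he γ)
    rw [hl, hw]

/-- **Clean twisted arrival sums are transported**: `A_ξ(T z; T Λ, T a) = A_ξ(z; Λ, a)` for every
automorphism `T` of `ℍ` acting on the centres by a translation. [folklore] -/
theorem arrivalSum_image (T : hexGraph ≃g hexGraph) {β : ℂ}
    (hT : ∀ f : HexVertex, hexCenter (T f) = hexCenter f + β) (Λ : Finset HexVertex)
    (a : Sym2 HexVertex) (θa ξ : ℝ) (z : HexVertex) :
    arrivalSum (Λ.image T) (a.map T) θa ξ (T z) = arrivalSum Λ a θa ξ z := by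
  unfold arrivalSum
  rw [star_image, Finset.sum_image T.injective.injOn]
  exact Finset.sum_congr rfl fun s _ =>
    sum_walks_image T hT Λ a θa ξ s z (fun l => l.getLast? = some s ∧ z ∉ l)
      (fun l => l.getLast? = some (T s) ∧ T z ∉ l) fun l =>
      and_congr (getLast?_map_eq_some_iff T l s)
        (not_congr (List.mem_map_of_injective T.injective))

/-- **Full via-dart sums are transported**: `Ā_ξ(T z; T Λ, T a) = Ā_ξ(z; Λ, a)` for every
automorphism `T` of `ℍ` acting on the centres by a translation. [folklore] -/
theorem viaSum_image (T : hexGraph ≃g hexGraph) {β : ℂ}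
    (hT : ∀ f : HexVertex, hexCenter (T f) = hexCenter f + β) (Λ : Finset HexVertex)
    (a : Sym2 HexVertex) (θa ξ : ℝ) (z : HexVertex) :
    viaSum (Λ.image T) (a.map T) θa ξ (T z) = viaSum Λ a θa ξ z := by
  unfold viaSum
  rw [star_image, Finset.sum_image T.injective.injOn]
  exact Finset.sum_congr rfl fun s _ =>
    sum_walks_image T hT Λ a θa ξ s z (fun l => l.getLast? = some s)
      (fun l => l.getLast? = some (T s)) fun l => getLast?_map_eq_some_iff T l s

/-! ### The registered packaging -/

/-- **Registered sub-goal `ss_translation_covariance`** (crux item stmt-CriticalPhenomena-8549, line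
`sector-slaving`, helper stub H1 of lead c4): (i) two honeycomb vertices of the same sublattice are
exchanged by a graph automorphism of `ℍ` acting on the face centres by a translation; (ii) every
such automorphism transports the clean twisted arrival sums `A_ξ` and the full via-dart sums `Ā_ξ`;
(iii) likewise the star mass, the root direction, the star, depth and simple connectivity.
[folklore] -/
theorem ss_translation_covariance :
    (∀ t t' : HexVertex, t.2 = t'.2 →
      ∃ (T : hexGraph ≃g hexGraph) (β : ℂ), T t = t' ∧
        ∀ f : HexVertex, hexCenter (T f) = hexCenter f + β) ∧
    (∀ (T : hexGraph ≃g hexGraph) (β : ℂ), (∀ f : HexVertex, hexCenter (T f) = hexCenter f + β) →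
      ∀ (Λ : Finset HexVertex) (a : Sym2 HexVertex) (θa ξ : ℝ) (z : HexVertex),
        arrivalSum (Λ.image T) (a.map T) θa ξ (T z) = arrivalSum Λ a θa ξ z ∧
          viaSum (Λ.image T) (a.map T) θa ξ (T z) = viaSum Λ a θa ξ z) ∧
    (∀ (T : hexGraph ≃g hexGraph) (β : ℂ), (∀ f : HexVertex, hexCenter (T f) = hexCenter f + β) →
      ∀ (Λ : Finset HexVertex) (u w z : HexVertex),
        mass (Λ.image T) (T u) (T w) (T z) = mass Λ u w z ∧ rootAngle (T u) (T w) = rootAngle u w ∧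
          star (Λ.image T) (T z) = (star Λ z).image T ∧
          (∀ R : ℝ, Deep Λ z R ↔ Deep (Λ.image T) (T z) R) ∧
          (hexDomainSimplyConnected Λ ↔ hexDomainSimplyConnected (Λ.image T))) := by
  refine ⟨exists_translation, fun T _ hT Λ a θa ξ z => ?_, fun T _ hT Λ u w z => ?_⟩
  · exact ⟨arrivalSum_image T hT Λ a θa ξ z, viaSum_image T hT Λ a θa ξ z⟩
  · exact ⟨mass_image T hT Λ u w z, rootAngle_map T hT u w, star_image T Λ z,
      fun R => deep_image_iff T hT Λ z R,
      (InteriorFlattening.Liouville.Transport.hexDomainSimplyConnected_image_iff T Λ).symm⟩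

end Summit.CriticalPhenomena.SAWScalingLimit.Theorems.DefectDecoherence.SectorSlaving

end
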